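import Mathlib
import Summits.Ventures.PercRepro2.FiveTypedCore11
import Summits.Ventures.PercRepro2.FiveTypedCore12
import Summits.Ventures.PercRepro2.FiveTypedCore21
import Summits.Ventures.PercRepro2.FiveTypedCore22

/-!
# Five typed edges: the sorted core (blind cell PercRepro2, night-3, 2026-08-24)

`typedCount_quint_core`: for five distinct typed edges whose ends give a SORTED least-representative
labelling of the fifteen points, the typed count of `K₃` is nonnegative, modulo `allOk4 = true`
and `allOk5 = true` — the roots joined ⇒ 0; a loop or an alone end ⇒ inert (`nonneg_of_loop5`,
`nonneg_of_alone5`); otherwise `okQ5_of_canon`, `cube_states5`, `okQ5_ineq_t`, `typedCount_quint`.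
-/

namespace Summit.Ventures.PercRepro2

open UnionCluster

namespace CovForm

namespace TwoTyped

open OneTyped TypedRed

section Core5

open Classical

variable {V : Type*} {E : Type*} [Fintype E] [DecidableEq E] {R : Type*} [Field R]
  [LinearOrder R] [IsStrictOrderedRing R]
variable (ends : E → Sym2 V) (o a₁ a₂ a₃ b : V)

/-- **Five typed edges, the sorted core**: for five distinct typed edges whose ends `ps` give a
SORTED least-representative labelling of the fifteen points in the closed configuration, the typed
count of `K₃` is nonnegative (modulo `allOk4 = true` and `allOk5 = true`). -/
theorem typedCount_quint_core (hall4 : allOk4 = true) (hall5 : allOk5 = true) (e₁ e₂ e₃ e₄ e₅ : E)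
    (h12 : e₁ ≠ e₂) (h13 : e₁ ≠ e₃) (h14 : e₁ ≠ e₄) (h15 : e₁ ≠ e₅) (h23 : e₂ ≠ e₃) (h24 : e₂ ≠ e₄) (h25 : e₂ ≠ e₅) (h34 : e₃ ≠ e₄) (h35 : e₃ ≠ e₅) (h45 : e₄ ≠ e₅) (z : Config E) (τ : E → ℕ)
    (hτ : ∀ e ∈ ({e₁, e₂, e₃, e₄, e₅} : Finset E), τ e = 1 ∨ τ e = 2)
    (h₁ : τ e₁ = 1 ∨ τ e₁ = 2) (h₂ : τ e₂ = 1 ∨ τ e₂ = 2) (h₃ : τ e₃ = 1 ∨ τ e₃ = 2) (h₄ : τ e₄ = 1 ∨ τ e₄ = 2) (h₅ : τ e₅ = 1 ∨ τ e₅ = 2)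
    (ps : Fin 5 → V × V)
    (hends₁ : ends e₁ = s((ps 0).1, (ps 0).2))
    (hends₂ : ends e₂ = s((ps 1).1, (ps 1).2))
    (hends₃ : ends e₃ = s((ps 2).1, (ps 2).2))
    (hends₄ : ends e₄ = s((ps 3).1, (ps 3).2))
    (hends₅ : ends e₅ = s((ps 4).1, (ps 4).2))
    (hsort : Sorted10 ends o a₁ a₂ a₃ b (closedOn ({e₁, e₂, e₃, e₄, e₅} : Finset E) z) ps) :
    0 ≤ typedCount {e₁, e₂, e₃, e₄, e₅} z τ (K3 ends o a₁ a₂ a₃ b : Config E → Config E → Config E → R) := by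
  rcases h₁ with h | h <;> rcases h₂ with h' | h'
  · exact typedCount_quint_core_11 ends o a₁ a₂ a₃ b hall4 hall5 e₁ e₂ e₃ e₄ e₅ h12 h13 h14 h15 h23 h24 h25 h34 h35 h45 z τ hτ h h' h₃ h₄ h₅ ps hends₁ hends₂ hends₃ hends₄ hends₅ hsort
  · exact typedCount_quint_core_12 ends o a₁ a₂ a₃ b hall4 hall5 e₁ e₂ e₃ e₄ e₅ h12 h13 h14 h15 h23 h24 h25 h34 h35 h45 z τ hτ h h' h₃ h₄ h₅ ps hends₁ hends₂ hends₃ hends₄ hends₅ hsort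
  · exact typedCount_quint_core_21 ends o a₁ a₂ a₃ b hall4 hall5 e₁ e₂ e₃ e₄ e₅ h12 h13 h14 h15 h23 h24 h25 h34 h35 h45 z τ hτ h h' h₃ h₄ h₅ ps hends₁ hends₂ hends₃ hends₄ hends₅ hsort
  · exact typedCount_quint_core_22 ends o a₁ a₂ a₃ b hall4 hall5 e₁ e₂ e₃ e₄ e₅ h12 h13 h14 h15 h23 h24 h25 h34 h35 h45 z τ hτ h h' h₃ h₄ h₅ ps hends₁ hends₂ hends₃ hends₄ hends₅ hsort

end Core5

end TwoTyped

end CovForm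

end Summit.Ventures.PercRepro2
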